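import Literature.AnabelianGeometry.EtaleTheta.Discharge.Sec2Cor218Cor219AtModelChi
import Literature.AnabelianGeometry.EtaleTheta.Discharge.Sec2Prop214iiiCuspLabels
import Literature.AnabelianGeometry.EtaleTheta.Discharge.Sec2Prop24ModelCharacteristic
import HarnessLib

/-!
# [EtTh] Prop. 2.14 (iii) at the empty `Y`-labelling, the `ThetaEnvData` fibre clause of Cor. 2.18 (iv), and
# the uniqueness clause of Prop. 2.4 AT THE RECORD MODEL `ThetaSetting.modelχ p` (proof-only; FACT-LIST rows
# F-0633, F-0634, F-0638)

Mochizuki, *The Étale Theta Function …* [EtTh], Publ. RIMS **45** (2009), §2: Prop. 2.4 p. 38, Prop. 2.14 (iii)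
pp. 49–50, Cor. 2.18 (iii) p. 61, Cor. 2.18 (iv) pp. 61–63 (PRIMS PDF pages; bib key `MochizukiEtTh2009`); [SemiAnbd]
Ex. 3.10 p. 45.  Cell `abc-iut`, block F, seat abc-iut-f-150 (gen 2); sequel of this seat's
`Sec2Cor218Cor219AtModelChi.lean` (p438416).  PROOF-ONLY: no definition, no instance, no new named fact.

* F-0634 / F-0633 (`RigidData.Prop214_iii_mono` / `_bi`): abc-iut-f-148/f-149's `Sec2Prop214iiiCuspLabels.lean`
  proves
  both clauses for abc-iut-L2-t8's rigidity data AT THE EMPTY `Y`-labelling, GIVEN Cor. 2.18 (iii) (quotient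
  clause, F-0623) of the model — which at the record model is this seat's THEOREM
  `rigidData_cor218_iii_quotient_modelχ` (temp-slimness of `Π^tp_X = Γ ⋊_χ G_{ℚ_p}`, abc-iut-w5-d111).  Hence
  `rigidData_prop214_iii_mono_modelχ_of_cuspLabels_empty`, `…_bi_…`: binder-free beyond the construction data, the
  `X`-labelling and Prop. 1.5 (iii) (input of `rigidData`).  (The rows stay SCHEMAS in the labelling: at the
  degenerate labelling they FAIL for every datum, `not_forall_cuspLabels_rigidData_prop214_iii_mono`.)
* F-0638 (`ThetaEnvData.Cor218_iv_fibre`) in `ThetaEnvData` currency at the record model: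
  `thetaEnvData_cor218_iv_fibre_modelχ` — lane C2's `thetaEnvData_cor218_iv_fibre_of_origin` with
  `IsEtThOrigin`,
  `hYcl` SUPPLIED (the `RigidData` twin F-0624 is abc-iut-f-149's `rigidData_cor218_iv_fibre_modelχ`).
* Prop. 2.4, uniqueness of the extension `Π^tp_{X̲̲} ≃ Π^tp_{X̲̲} ⇝ Π^tp_X ≃ Π^tp_X` at the record model:
  `prop24_extension_unique_modelχ`, `existsUnique_extension_of_prop24_modelχ` — abc-iut-L2's
  `prop24_extension_unique` / `existsUnique_extension_of_prop24` with temp-slimness SUPPLIED.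

HONEST LABEL: semi-synthetic model (not the tempered `π₁` of a curve); nothing of [EtTh] / [SemiAnbd] asserted; no
side taken on [IUTchIII] Cor. 3.12; typed ≠ proved; a FACT row is an assumption label.
-/

noncomputable section

namespace Literature.AnabelianGeometry.EtaleTheta.SettingModel

open Literature.AnabelianGeometry.SemiGraphs
open Literature.AlgebraicGeometry.Frobenioids (IsSlimGroup)

variable (p : ℕ) [Fact p.Prime]
variable {E : (ThetaSetting.modelχ p).EtaleThetaData} {l : ℕ} (C : E.DoubleUnderline l) {N : ℕ+}
  (μ : (ThetaSetting.modelχ p).CyclotomeMod l N)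

/-! ## Prop. 2.14 (iii) at the empty `Y`-labelling — F-0634 / F-0633 at the record model -/

/-- **F-0634 `RigidData.Prop214_iii_mono` HOLDS at the record model's rigidity data with the EMPTY
`Y`-labelling** (any `X`-labelling `cX`): abc-iut-f-148/f-149's `rigidData_prop214_iii_mono_of_cuspLabels_empty`
with its Cor. 2.18 (iii) input SUPPLIED by `rigidData_cor218_iii_quotient_modelχ`. [cite: MochizukiEtTh2009, Prop 2.14(iii) p.49] -/
theorem rigidData_prop214_iii_mono_modelχ_of_cuspLabels_empty (hC : (ThetaSetting.modelχ p).Compat)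
    (hS : (ThetaSetting.modelχ p).Sec2Hyps) (h15 : ThetaSetting.Prop15iii E hC)
    (cX : ZMod l → Set (Subgroup C.Huu)) (hcX : ∀ a, cX (-a) = cX a) :
    Literature.AnabelianGeometry.EtaleTheta.RigidData.Prop214_iii_mono
      (C.rigidData μ hC hS h15 ⟨fun _ => ∅, cX, hcX⟩) :=
  C.rigidData_prop214_iii_mono_of_cuspLabels_empty μ hC hS h15 cX hcX
    (rigidData_cor218_iii_quotient_modelχ p C μ hC hS h15 _)

/-- **F-0633 `RigidData.Prop214_iii_bi` HOLDS at the record model's rigidity data with the EMPTY `Y`-labelling.**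
[cite: MochizukiEtTh2009, Prop 2.14(iii) p.50] -/
theorem rigidData_prop214_iii_bi_modelχ_of_cuspLabels_empty (hC : (ThetaSetting.modelχ p).Compat)
    (hS : (ThetaSetting.modelχ p).Sec2Hyps) (h15 : ThetaSetting.Prop15iii E hC)
    (cX : ZMod l → Set (Subgroup C.Huu)) (hcX : ∀ a, cX (-a) = cX a) :
    Literature.AnabelianGeometry.EtaleTheta.RigidData.Prop214_iii_bi
      (C.rigidData μ hC hS h15 ⟨fun _ => ∅, cX, hcX⟩) :=
  C.rigidData_prop214_iii_bi_of_cuspLabels_empty μ hC hS h15 cX hcX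
    (rigidData_cor218_iii_quotient_modelχ p C μ hC hS h15 _)

/-- **Both Prop. 2.14 (iii) clauses at the record model, empty `Y`-labelling, with `Sec2Hyps` / `Compat` ALSO
supplied** (`modelχ_sec2Hyps`, `compat_modelχ`): binders = construction data, `X`-labelling, Prop. 1.5 (iii).
[cite: MochizukiEtTh2009, Prop 2.14(iii) p.49] -/
theorem rigidData_prop214_iii_modelχ_of_cuspLabels_empty_holds
    (h15 : ThetaSetting.Prop15iii E (compat_modelχ p))
    (cX : ZMod l → Set (Subgroup C.Huu)) (hcX : ∀ a, cX (-a) = cX a) :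
    Literature.AnabelianGeometry.EtaleTheta.RigidData.Prop214_iii_mono
        (C.rigidData μ (compat_modelχ p) (ThetaSetting.modelχ_sec2Hyps p) h15 ⟨fun _ => ∅, cX, hcX⟩) ∧
      Literature.AnabelianGeometry.EtaleTheta.RigidData.Prop214_iii_bi
        (C.rigidData μ (compat_modelχ p) (ThetaSetting.modelχ_sec2Hyps p) h15 ⟨fun _ => ∅, cX, hcX⟩) :=
  ⟨rigidData_prop214_iii_mono_modelχ_of_cuspLabels_empty p C μ _ _ h15 cX hcX,
    rigidData_prop214_iii_bi_modelχ_of_cuspLabels_empty p C μ _ _ h15 cX hcX⟩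

/-! ## Cor. 2.18 (iv), fibres, in `ThetaEnvData` currency — F-0638 at the record model -/

/-- **F-0638 `ThetaEnvData.Cor218_iv_fibre` HOLDS at the record model** (for every `E`, `X̲̲`, level; modulo
Prop. 1.5 (iii) and a labelling, the inputs of `rigidData` through which lane C2 proves it):
`thetaEnvData_cor218_iv_fibre_of_origin` with `IsEtThOrigin`, `hYcl` SUPPLIED. [cite: MochizukiEtTh2009, Cor 2.18(iv) p.61] -/
theorem thetaEnvData_cor218_iv_fibre_modelχ (hC : (ThetaSetting.modelχ p).Compat)
    (hS : (ThetaSetting.modelχ p).Sec2Hyps) (h15 : ThetaSetting.Prop15iii E hC) (L : C.CuspLabels) :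
    Literature.AnabelianGeometry.EtaleTheta.ThetaEnvData.Cor218_iv_fibre (C.thetaEnvData μ hC hS) :=
  C.thetaEnvData_cor218_iv_fibre_of_origin μ hC hS h15 L (ThetaSetting.modelχ_isEtThOrigin p) (hYcl_modelχ p)

/-! ## Prop. 2.4: uniqueness of the extension at the record model -/

/-- **Prop. 2.4 at the record model — the extension of `γ ∈ Aut(Π^tp_{X̲̲})` to `Π^tp_X` is UNIQUE** (two
topological automorphisms of `Π^tp_X` agreeing on the open subgroup `Π^tp_{X̲̲}` coincide): abc-iut-L2's
`prop24_extension_unique` with temp-slimness SUPPLIED by `isSlimGroup_piTemp_modelχ`. [cite: MochizukiEtTh2009, Prop 2.4 p.38] -/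
theorem prop24_extension_unique_modelχ (γ : C.Huu ≃ₜ* C.Huu)
    (Γ Γ' : (ThetaSetting.modelχ p).PiTemp ≃ₜ* (ThetaSetting.modelχ p).PiTemp)
    (hΓ : ∀ h : C.Huu, (Γ h : (ThetaSetting.modelχ p).PiTemp) = γ h)
    (hΓ' : ∀ h : C.Huu, (Γ' h : (ThetaSetting.modelχ p).PiTemp) = γ h) : Γ = Γ' :=
  C.prop24_extension_unique (isSlimGroup_piTemp_modelχ p) γ Γ Γ' hΓ hΓ'

/-- **Prop. 2.4 at the record model — UNIQUE existence of the extension**, given the existence clause `hP24`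
(abc-iut-L2's `existsUnique_extension_of_prop24` with temp-slimness SUPPLIED).
[cite: MochizukiEtTh2009, Prop 2.4 p.38] -/
theorem existsUnique_extension_of_prop24_modelχ
    (hP24 : ∀ γ : C.Huu ≃ₜ* C.Huu, ∃ Γ : (ThetaSetting.modelχ p).PiTemp ≃ₜ* (ThetaSetting.modelχ p).PiTemp,
      (∀ h : C.Huu, (Γ h : (ThetaSetting.modelχ p).PiTemp) = γ h) ∧
        (ThetaSetting.modelχ p).GtpYdd.map Γ.toMulEquiv.toMonoidHom = (ThetaSetting.modelχ p).GtpYdd)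
    (γ : C.Huu ≃ₜ* C.Huu) :
    ∃! Γ : (ThetaSetting.modelχ p).PiTemp ≃ₜ* (ThetaSetting.modelχ p).PiTemp,
      ∀ h : C.Huu, (Γ h : (ThetaSetting.modelχ p).PiTemp) = γ h :=
  C.existsUnique_extension_of_prop24 (isSlimGroup_piTemp_modelχ p) hP24 γ

end Literature.AnabelianGeometry.EtaleTheta.SettingModel

end
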